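import Summits.BirchSwinnertonDyer.Rank1Residual.GaloisImage.SakamotoN11Instance
import Summits.BirchSwinnertonDyer.Rank1Residual.GaloisImage.KolyvaginDeepSubclass
import Summits.BirchSwinnertonDyer.Rank1Residual.GaloisImage.KolyvaginDeepSubclassTransport
import HarnessLib

/-!
# The N11 instance of Sakamoto 2024 Thm. 4.4 (1)(2) on the DEEP Frobenius sub-class
# (`T = E[3^{k+1}]`, class through `E[3^{k′+1}]` at `3^{k′+1}`, `k ≤ k′`) — consumer instance of the
# S24-DEEP port (cell `b2b-bsdres`, team n1011, seat p15 GEN 3, OWNERS row T-S24D = route planner 1's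
# R1-47 (a), `cells/n1011/ROUTE-1.md` §27.6 / §28.4; file 2 of the row)

HONEST FRAMING (cell `b2b-bsdres`, run/shared/lean/b2b/bsd-rank1-residual/, verbatim in every
file): the goal of the cell is to DELETE the COMBINATION-SHAPED residual classes of the
Birch–Swinnerton-Dyer formula for ALL analytic-rank `≤ 1` elliptic curves over `ℚ` — "full BSD
formula for every rank `≤ 1` curve in class `C`" assembled STRICTLY from published theorems — so
that the rank-`≤ 1` remainder becomes exactly the CONSTRUCTION-SHAPED classes, which are TYPED
(missing-input `Prop`s), NOT attempted. This is not "finishing BSD". Team n1011 (N10 / N11, the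
additive block X4 ∧ `p = 3`): research route on the CONSTRUCTION-SHAPED class X4; no claim beyond
the stated classes; nothing is booked; no label and no RESIDUAL-MAP mark is moved. Theorems only (no
definition, no named fact, no `sorry`).  Every theorem here is CONDITIONAL on the S24-DEEP PORT of
cc-typer-1's `KolyvaginDeepSubclass.lean` (p268594; typed inputs
`S24Deep.kolyvaginSystems_freeRankOne_zmod_three_pow_deep` /
`S24Deep.kolyvaginSystems_idealOfBasis_eq_fittingIdeal_zmod_three_pow_deep`, flag `S24-DEEP-PORT@3`,
taken as the hypotheses `hS24d` / `hS24d₂`) exactly as n1011-p13's instances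
(`SakamotoN11Instance*.lean`) are conditional on the pinned facts `hS24` / `hS24₂`.

## What and why

On class-A2 rows (`E(ℚ₃)[3] ≠ 0`; cell convention (B6)) the END THEOREM of sub-route (a′)
(`Assembly.padicValRat_le_of_certificate_of_transport`, n1011-p18, p271924) needs, at every depth
`k′`, Sakamoto's Thm. 4.4 for the module `T = E[3^{k+1}]` and a Kolyvagin datum whose primes are the
DEEP sub-class `𝒫′ = frobeniusClassPrimes (E[3^{k′+1}]) S τ 3^{k′+1}` — the generator `g′` of `KS₁`
with its order and generation property (`hg′`, `hgo′`, `hgen′`) and Thm. 4.4 (2) in ORDER form at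
every level (`hR22′`).  This file is n1011-p13's `kolyvaginSystems_freeRankOne_propagatedSelmerStructure`
(p255331) / `…idealOfBasis…_of_towerSurj` (p263462) RE-RUN on the deep class over the port, with
the port's four deltas discharged by theorems of the tree:

* (Δ1) `ker ρ_{E[3^{k′+1}]} ≤ ker ρ_{E[3^{k+1}]}` — cc-typer-1's
  `S24Deep.torsionGaloisModule_pow_mul_eq_one_of_le`; `E[3^{k′+1}]` unramified outside `S` — ONE
  binder `hS″` at level `k′`, the level-`k` clause derived (`isUnramifiedAt_torsionGaloisModule_of_dvd`);
* (Δ2) (H.2) with `τ ∈ Gal(ℚ̄/ℚ(μ_{3^{k′+1}}))` and `E[3^{k+1}]/(τ − 1) ≅ ℤ/3^{k+1}` — binders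
  `hτμ`, `hτq` (both hold for the tower's `σ`, `exists_torsion_quotient_equiv_zmod_of_towerSurj`);
* (Δ3) (H.3′) at `ℚ(μ_{3^{k′+1}}, E[3^{k′+1}])` — LITERALLY n1011-p04's `hH3_three_of_towerSurj W k′`;
* (Δ4) `D.primes = 𝒫′` — the binder `hP`.

and everything else discharged exactly as in p13's p255331 / p263462: Sakamoto's residual pair, the
free `ℤ/3^{k+1}`-module `E[3^{k+1}]`, (H.1) from surj(3), cartesian at every place,
`𝓕̄ = propagatedSelmerStructureOne`.  The binder list is p13's with `hS′` split into `h3S′` (`3 ∉ v`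
off `S`) and `hS″` (unramified for `E[3^{k′+1}]` off `S`) and (H.3) replaced by (H.3′); at `k′ = k` it is
p13's list on the nose (the closing `example`, cc-typer-1's conservativity regression).  The sequel
`SakamotoN11InstanceDeepTower.lean` discharges (H.3′), (H.SD), coisotropy, `hS′`/`hS″`/`hunr` and the
core rank under the tower and unpacks ONE generator `κ` serving p271924's `(g′, hg′, hgo′, hgen′)` and
`hR22′` simultaneously; the deep datum itself EXISTS by file 1 (`KolyvaginDeepDatum.lean`,
`S24Deep.exists_eta_kolyvaginDatum_torsion_pow_mul_deep`).

References: R. Sakamoto, JTNB **36** (2024) §2, Def. 3.5–3.8, Def. 4.2, Thm. 4.4 (pp. 920–926),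
Lemma 5.2 / Cor. 5.5 (pp. 928–929) [Sakamoto2024]; B. Mazur, K. Rubin, Mem. AMS **799** (2004) §3.5
(H.5), Cor. 4.5.2 (iv), Prop. A.2 [MazurRubin2004]; J. S. Milne, *ADT* I Thm. 2.8 [MilneADT2006].
-/

noncomputable section

open scoped Classical NumberField ContRepresentation
open Field NumberField IsDedekindDomain
open WeierstrassCurve Literature.NumberTheory.EllipticCurves Literature.NumberTheory.GaloisRepresentations
  Literature.NumberTheory.GaloisRepresentations.DiscreteGaloisModule Literature.NumberTheory.GaloisCohomology

namespace Summit.BirchSwinnertonDyer.Rank1Residual.GaloisImage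

variable (W : WeierstrassCurve ℚ) [W.IsElliptic]

/-! ### Thm. 4.4 (1) on the deep class, p13's binder shape -/

/-- **The N11 instance of S24-DEEP (1)** (`T = E[3^{k+1}]`, `𝓕 = 𝓕_can = propagatedSelmerStructure W 3 k`,
Kolyvagin datum on the DEEP class through `E[3^{k′+1}]` at `3^{k′+1}`, `k ≤ k′`): `KS₁` is free of rank
one over `ℤ/3^{k+1}` with the level-wise bijectivity clause.  Discharged (as in p255331): the residual
pair, the free module, (H.1) from surj(3), cartesian, `𝓕̄ = propagatedSelmerStructureOne`; and (Δ1)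
`ker ρ′ ≤ ker ρ`.  Explicit: the port `hS24d`, the tower (surj(3) is all that (H.1) uses, but the deep
class is void without it), `τ` with (Δ2), (H.3′) `hH3'` in the port's shape, `θ`/`hθ`, `inv` ×4, `S`
with `hS`, `hS″` (unramified for `E[3^{k′+1}]`, hence for `E[3^{k+1}]`), `h3S'` (`3 ∉ v` off `S`),
`hunr`, core rank `hCR`, coisotropy `hco`, the datum with (Δ4) `hP`.  CONDITIONAL on the port.
[cite: Sakamoto2024, Thm. 4.4 (1) (p. 926); §2 (pp. 920–921); Cor. 5.5 (p. 929)]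
[cite: MazurRubin2004, §3.5 (H.5) (p. 27) and Prop. A.2 (pp. 79–80)] -/
theorem kolyvaginSystems_freeRankOne_propagatedSelmerStructure_deep
    (hS24d : S24Deep.kolyvaginSystems_freeRankOne_zmod_three_pow_deep) {k k' : ℕ} (hkk' : k ≤ k')
    [Finite (geomTorsion W ((3 : ℕ) : ℤ))] [Finite (geomTorsion W (((3 : ℕ) : ℤ) ^ k * ((3 : ℕ) : ℤ)))]
    [Finite (geomTorsion W (((3 : ℕ) : ℤ) ^ k' * ((3 : ℕ) : ℤ)))]
    (h3 : W.HasSurjectiveModNGaloisRep ((3 : ℕ) : ℤ))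
    (τ : absoluteGaloisGroup ℚ) (hτμ : τ ∈ rootsOfUnityFixer ℚ (3 ^ (k' + 1)))
    (hτq : Nonempty (cokerSubOne (W.torsionGaloisModule (((3 : ℕ) : ℤ) ^ k * ((3 : ℕ) : ℤ))) τ ≃+
      ZMod (3 ^ (k + 1))))
    (hH3' : ∀ f : contOneCocycles (W.torsionGaloisModule ((3 : ℕ) : ℤ)).toTopRep,
      (∀ u : absoluteGaloisGroup ℚ, (W.torsionGaloisModule (((3 : ℕ) : ℤ) ^ k' * ((3 : ℕ) : ℤ))) u = 1 →
        u ∈ rootsOfUnityFixer ℚ (3 ^ (k' + 1)) → f.1 u = 0) →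
        oneCocycleClass (W.torsionGaloisModule ((3 : ℕ) : ℤ)).toTopRep f = 0)
    (θ : (W.torsionGaloisModule ((3 : ℕ) : ℤ)).toContRepresentation →ⁱL
      ((W.torsionGaloisModule ((3 : ℕ) : ℤ)).tateDual 3).toContRepresentation)
    (hθ : Function.Bijective θ)
    (inv : LocalInvariants ℚ 3) (hperf : inv.IsPerfect) (hsum : inv.SumLocalTermEqZero)
    (hunro : inv.UnramifiedOrthogonal) (hcompl : inv.SelmerComplement)
    (S : Finset (Place ℚ)) (hS : ∀ w : InfinitePlace ℚ, (Sum.inl w : Place ℚ) ∈ S)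
    (h3S' : ∀ v : HeightOneSpectrum (𝓞 ℚ), (Sum.inr v : Place ℚ) ∉ S → ((3 : ℕ) : 𝓞 ℚ) ∉ v.asIdeal)
    (hS'' : ∀ v : HeightOneSpectrum (𝓞 ℚ), (Sum.inr v : Place ℚ) ∉ S →
      GaloisRep.IsUnramifiedAt v (W.torsionGaloisModule (((3 : ℕ) : ℤ) ^ k' * ((3 : ℕ) : ℤ))))
    (hunr : (propagatedSelmerStructure W 3 k).IsUnramifiedOutside S)
    (hCR : LocalInvariants.HasCoreRank inv (propagatedSelmerStructureOne W 3) 3 1)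
    (hco : inv.IsResiduallyCoisotropic (propagatedSelmerStructureOne W 3) θ S)
    (D : KolyvaginDatum (W.torsionGaloisModule (((3 : ℕ) : ℤ) ^ k * ((3 : ℕ) : ℤ))))
    (η : (q : HeightOneSpectrum (𝓞 ℚ)) → (ZMod (Ideal.absNorm q.asIdeal))ˣ)
    (hP : D.primes = frobeniusClassPrimes (W.torsionGaloisModule (((3 : ℕ) : ℤ) ^ k' * ((3 : ℕ) : ℤ)))
      {v | (Sum.inr v : Place ℚ) ∈ S} τ (3 ^ (k' + 1)))
    (hT : D.transverse = cyclotomicTransverse (W.torsionGaloisModule (((3 : ℕ) : ℤ) ^ k * ((3 : ℕ) : ℤ))))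
    (hD : D.HasCanonicalComparison (3 ^ (k + 1)) η) :
    KolyvaginSystem.IsFreeRankOneZMod (D.kolyvaginSystems (propagatedSelmerStructure W 3 k))
        (3 ^ (k + 1)) ∧
      ∀ (d : Finset (HeightOneSpectrum (𝓞 ℚ))) (hd : D.IsLevel d),
        LocalInvariants.lambdaStar inv ((D.atLevel (propagatedSelmerStructure W 3 k) d).induced
          (W.torsionMulBy (((3 : ℕ) : ℤ) ^ k) ((3 : ℕ) : ℤ))) 3 = 0 →
        Function.Bijective fun κ : D.kolyvaginSystems (propagatedSelmerStructure W 3 k) =>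
          (⟨κ.1 d, ((KolyvaginDatum.mem_kolyvaginSystems_iff D _ κ.1).mp κ.2).mem_selmerGroup
              d hd⟩ : (D.atLevel (propagatedSelmerStructure W 3 k) d).selmerGroup) := by
  haveI : NeZero ((3 : ℕ) : ℚ) := ⟨by norm_num⟩
  have hcart := isCartesian_propagatedSelmerStructure W 3 k S
  have hCR' : LocalInvariants.HasCoreRank inv
      ((propagatedSelmerStructure W 3 k).induced (W.torsionMulBy (((3 : ℕ) : ℤ) ^ k) ((3 : ℕ) : ℤ))) 3 1 := by
    rw [induced_propagatedSelmerStructure]; exact hCR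
  have hco' : inv.IsResiduallyCoisotropic
      ((propagatedSelmerStructure W 3 k).induced (W.torsionMulBy (((3 : ℕ) : ℤ) ^ k) ((3 : ℕ) : ℤ))) θ S := by
    rw [induced_propagatedSelmerStructure]; exact hco
  have hS' : ∀ v : HeightOneSpectrum (𝓞 ℚ), (Sum.inr v : Place ℚ) ∉ S →
      ((3 : ℕ) : 𝓞 ℚ) ∉ v.asIdeal ∧
        GaloisRep.IsUnramifiedAt v (W.torsionGaloisModule (((3 : ℕ) : ℤ) ^ k * ((3 : ℕ) : ℤ))) :=
    fun v hv => ⟨h3S' v hv, S24Deep.isUnramifiedAt_torsionGaloisModule_of_dvd W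
      (mul_dvd_mul_right (pow_dvd_pow ((3 : ℕ) : ℤ) hkk') ((3 : ℕ) : ℤ)) v (hS'' v hv)⟩
  exact hS24d (geomTorsion W (((3 : ℕ) : ℤ) ^ k * ((3 : ℕ) : ℤ))) (geomTorsion W ((3 : ℕ) : ℤ)) (k + 1)
    (geomTorsion W (((3 : ℕ) : ℤ) ^ k' * ((3 : ℕ) : ℤ))) (k' + 1)
    (W.torsionGaloisModule _) (W.torsionGaloisModule _) (W.torsionGaloisModule _)
    (W.torsionMulBy (((3 : ℕ) : ℤ) ^ k) ((3 : ℕ) : ℤ))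
    (W.torsionInclusion (Dvd.intro_left _ rfl)) τ θ inv S (propagatedSelmerStructure W 3 k) D η
    (Nat.succ_le_succ hkk')
    (fun u hu => S24Deep.torsionGaloisModule_pow_mul_eq_one_of_le W ((3 : ℕ) : ℤ) hkk' u hu)
    (torsionMulBy_pow_surjective W 3 k) (torsionMulBy_pow_eq_zero_iff W 3 k)
    (torsionInclusion_torsionMulBy_pow W 3 k) (residual_irreducible_of_surj W 3 h3) hτμ hτq
    hH3' hθ hperf hsum hunro hcompl hS hS' hS'' hunr hcart hCR' hco' hP hT hD

/-! ### Thm. 4.4 (2) on the deep class, ORDER form, p13's binder shape -/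

/-- **The N11 instance of S24-DEEP (2), ORDER form** (= the shape of p271924's `hR22′` at one depth):
for a `zmultiples`-basis `κ` of `KS₁(E[3^{k+1}], 𝓕_can, 𝒫′)` (deep class through `E[3^{k′+1}]`,
`k ≤ k′`), a level `d` of the datum and the full-level Poitou–Tate family `inv′` at `3^{k+1}`, with
`N_d` the dual Selmer group of `𝓕_can(d)`: `#N_d ∣ 3^{k+1} ⟹ ord(κ_d)·#N_d = 3^{k+1}` and
`3^{k+1} ∣ #N_d ⟹ κ_d = 0`.  Same discharges and same explicit binders as (1), plus `inv′` ×4, `κ`,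
`hκ`, `d`, `hd`.  CONDITIONAL on the port `hS24d₂`.
[cite: Sakamoto2024, Def. 4.2 and Thm. 4.4 (2) (p. 926), Prop. 7.7 (p. 936)]
[cite: MazurRubin2004, §3.5 (H.5) (p. 27) and Cor. 4.5.2 (iv) (p. 48)] -/
theorem kolyvaginSystems_idealOfBasis_propagatedSelmerStructure_deep
    (hS24d₂ : S24Deep.kolyvaginSystems_idealOfBasis_eq_fittingIdeal_zmod_three_pow_deep)
    {k k' : ℕ} (hkk' : k ≤ k')
    [Finite (geomTorsion W ((3 : ℕ) : ℤ))] [Finite (geomTorsion W (((3 : ℕ) : ℤ) ^ k * ((3 : ℕ) : ℤ)))]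
    [Finite (geomTorsion W (((3 : ℕ) : ℤ) ^ k' * ((3 : ℕ) : ℤ)))]
    (h3 : W.HasSurjectiveModNGaloisRep ((3 : ℕ) : ℤ))
    (τ : absoluteGaloisGroup ℚ) (hτμ : τ ∈ rootsOfUnityFixer ℚ (3 ^ (k' + 1)))
    (hτq : Nonempty (cokerSubOne (W.torsionGaloisModule (((3 : ℕ) : ℤ) ^ k * ((3 : ℕ) : ℤ))) τ ≃+
      ZMod (3 ^ (k + 1))))
    (hH3' : ∀ f : contOneCocycles (W.torsionGaloisModule ((3 : ℕ) : ℤ)).toTopRep,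
      (∀ u : absoluteGaloisGroup ℚ, (W.torsionGaloisModule (((3 : ℕ) : ℤ) ^ k' * ((3 : ℕ) : ℤ))) u = 1 →
        u ∈ rootsOfUnityFixer ℚ (3 ^ (k' + 1)) → f.1 u = 0) →
        oneCocycleClass (W.torsionGaloisModule ((3 : ℕ) : ℤ)).toTopRep f = 0)
    (θ : (W.torsionGaloisModule ((3 : ℕ) : ℤ)).toContRepresentation →ⁱL
      ((W.torsionGaloisModule ((3 : ℕ) : ℤ)).tateDual 3).toContRepresentation)
    (hθ : Function.Bijective θ)
    (inv : LocalInvariants ℚ 3) (hperf : inv.IsPerfect) (hsum : inv.SumLocalTermEqZero)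
    (hunro : inv.UnramifiedOrthogonal) (hcompl : inv.SelmerComplement)
    (S : Finset (Place ℚ)) (hS : ∀ w : InfinitePlace ℚ, (Sum.inl w : Place ℚ) ∈ S)
    (h3S' : ∀ v : HeightOneSpectrum (𝓞 ℚ), (Sum.inr v : Place ℚ) ∉ S → ((3 : ℕ) : 𝓞 ℚ) ∉ v.asIdeal)
    (hS'' : ∀ v : HeightOneSpectrum (𝓞 ℚ), (Sum.inr v : Place ℚ) ∉ S →
      GaloisRep.IsUnramifiedAt v (W.torsionGaloisModule (((3 : ℕ) : ℤ) ^ k' * ((3 : ℕ) : ℤ))))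
    (hunr : (propagatedSelmerStructure W 3 k).IsUnramifiedOutside S)
    (hCR : LocalInvariants.HasCoreRank inv (propagatedSelmerStructureOne W 3) 3 1)
    (hco : inv.IsResiduallyCoisotropic (propagatedSelmerStructureOne W 3) θ S)
    (D : KolyvaginDatum (W.torsionGaloisModule (((3 : ℕ) : ℤ) ^ k * ((3 : ℕ) : ℤ))))
    (η : (q : HeightOneSpectrum (𝓞 ℚ)) → (ZMod (Ideal.absNorm q.asIdeal))ˣ)
    (hP : D.primes = frobeniusClassPrimes (W.torsionGaloisModule (((3 : ℕ) : ℤ) ^ k' * ((3 : ℕ) : ℤ)))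
      {v | (Sum.inr v : Place ℚ) ∈ S} τ (3 ^ (k' + 1)))
    (hT : D.transverse = cyclotomicTransverse (W.torsionGaloisModule (((3 : ℕ) : ℤ) ^ k * ((3 : ℕ) : ℤ))))
    (hD : D.HasCanonicalComparison (3 ^ (k + 1)) η)
    (inv' : LocalInvariants ℚ (3 ^ (k + 1))) (hperf' : inv'.IsPerfect)
    (hsum' : inv'.SumLocalTermEqZero) (hunro' : inv'.UnramifiedOrthogonal)
    (hcompl' : inv'.SelmerComplement)
    (κ : D.kolyvaginSystems (propagatedSelmerStructure W 3 k)) (hκ : AddSubgroup.zmultiples κ = ⊤)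
    (d : Finset (HeightOneSpectrum (𝓞 ℚ))) (hd : D.IsLevel d) :
    (Nat.card (inv'.dualSelmerStructure (W.torsionGaloisModule (((3 : ℕ) : ℤ) ^ k * ((3 : ℕ) : ℤ)))
        (D.atLevel (propagatedSelmerStructure W 3 k) d)).selmerGroup ∣ 3 ^ (k + 1) →
      addOrderOf (κ.1 d) *
        Nat.card (inv'.dualSelmerStructure (W.torsionGaloisModule (((3 : ℕ) : ℤ) ^ k * ((3 : ℕ) : ℤ)))
          (D.atLevel (propagatedSelmerStructure W 3 k) d)).selmerGroup = 3 ^ (k + 1)) ∧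
    (3 ^ (k + 1) ∣ Nat.card (inv'.dualSelmerStructure
        (W.torsionGaloisModule (((3 : ℕ) : ℤ) ^ k * ((3 : ℕ) : ℤ)))
          (D.atLevel (propagatedSelmerStructure W 3 k) d)).selmerGroup → κ.1 d = 0) := by
  haveI : NeZero ((3 : ℕ) : ℚ) := ⟨by norm_num⟩
  have hcart := isCartesian_propagatedSelmerStructure W 3 k S
  have hCR' : LocalInvariants.HasCoreRank inv
      ((propagatedSelmerStructure W 3 k).induced (W.torsionMulBy (((3 : ℕ) : ℤ) ^ k) ((3 : ℕ) : ℤ))) 3 1 := by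
    rw [induced_propagatedSelmerStructure]; exact hCR
  have hco' : inv.IsResiduallyCoisotropic
      ((propagatedSelmerStructure W 3 k).induced (W.torsionMulBy (((3 : ℕ) : ℤ) ^ k) ((3 : ℕ) : ℤ))) θ S := by
    rw [induced_propagatedSelmerStructure]; exact hco
  have hS' : ∀ v : HeightOneSpectrum (𝓞 ℚ), (Sum.inr v : Place ℚ) ∉ S →
      ((3 : ℕ) : 𝓞 ℚ) ∉ v.asIdeal ∧
        GaloisRep.IsUnramifiedAt v (W.torsionGaloisModule (((3 : ℕ) : ℤ) ^ k * ((3 : ℕ) : ℤ))) :=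
    fun v hv => ⟨h3S' v hv, S24Deep.isUnramifiedAt_torsionGaloisModule_of_dvd W
      (mul_dvd_mul_right (pow_dvd_pow ((3 : ℕ) : ℤ) hkk') ((3 : ℕ) : ℤ)) v (hS'' v hv)⟩
  exact hS24d₂ (geomTorsion W (((3 : ℕ) : ℤ) ^ k * ((3 : ℕ) : ℤ))) (geomTorsion W ((3 : ℕ) : ℤ)) (k + 1)
    (geomTorsion W (((3 : ℕ) : ℤ) ^ k' * ((3 : ℕ) : ℤ))) (k' + 1)
    (W.torsionGaloisModule _) (W.torsionGaloisModule _) (W.torsionGaloisModule _)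
    (W.torsionMulBy (((3 : ℕ) : ℤ) ^ k) ((3 : ℕ) : ℤ))
    (W.torsionInclusion (Dvd.intro_left _ rfl)) τ θ inv S (propagatedSelmerStructure W 3 k) D η
    (Nat.succ_le_succ hkk')
    (fun u hu => S24Deep.torsionGaloisModule_pow_mul_eq_one_of_le W ((3 : ℕ) : ℤ) hkk' u hu)
    (torsionMulBy_pow_surjective W 3 k) (torsionMulBy_pow_eq_zero_iff W 3 k)
    (torsionInclusion_torsionMulBy_pow W 3 k) (residual_irreducible_of_surj W 3 h3) hτμ hτq
    hH3' hθ hperf hsum hunro hcompl hS hS' hS'' hunr hcart hCR' hco' hP hT hD inv' hperf' hsum' hunro'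
    hcompl' κ hκ d hd

/-! ### Conservativity regression (cc-typer-1's request): at `k′ = k` the deep instance has exactly
### p13's pinned binder list (`hS″ = hS′.2`) -/

example (hS24d : S24Deep.kolyvaginSystems_freeRankOne_zmod_three_pow_deep) (k : ℕ)
    [Finite (geomTorsion W ((3 : ℕ) : ℤ))] [Finite (geomTorsion W (((3 : ℕ) : ℤ) ^ k * ((3 : ℕ) : ℤ)))]
    (h3 : W.HasSurjectiveModNGaloisRep ((3 : ℕ) : ℤ))
    (τ : absoluteGaloisGroup ℚ) (hτμ : τ ∈ rootsOfUnityFixer ℚ (3 ^ (k + 1)))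
    (hτq : Nonempty (cokerSubOne (W.torsionGaloisModule (((3 : ℕ) : ℤ) ^ k * ((3 : ℕ) : ℤ))) τ ≃+
      ZMod (3 ^ (k + 1))))
    (hH3 : ∀ f : contOneCocycles (W.torsionGaloisModule ((3 : ℕ) : ℤ)).toTopRep,
      (∀ u : absoluteGaloisGroup ℚ, (W.torsionGaloisModule (((3 : ℕ) : ℤ) ^ k * ((3 : ℕ) : ℤ))) u = 1 →
        u ∈ rootsOfUnityFixer ℚ (3 ^ (k + 1)) → f.1 u = 0) →
        oneCocycleClass (W.torsionGaloisModule ((3 : ℕ) : ℤ)).toTopRep f = 0)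
    (θ : (W.torsionGaloisModule ((3 : ℕ) : ℤ)).toContRepresentation →ⁱL
      ((W.torsionGaloisModule ((3 : ℕ) : ℤ)).tateDual 3).toContRepresentation)
    (hθ : Function.Bijective θ)
    (inv : LocalInvariants ℚ 3) (hperf : inv.IsPerfect) (hsum : inv.SumLocalTermEqZero)
    (hunro : inv.UnramifiedOrthogonal) (hcompl : inv.SelmerComplement)
    (S : Finset (Place ℚ)) (hS : ∀ w : InfinitePlace ℚ, (Sum.inl w : Place ℚ) ∈ S)
    (hS' : ∀ v : HeightOneSpectrum (𝓞 ℚ), (Sum.inr v : Place ℚ) ∉ S →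
      ((3 : ℕ) : 𝓞 ℚ) ∉ v.asIdeal ∧ GaloisRep.IsUnramifiedAt v
        (W.torsionGaloisModule (((3 : ℕ) : ℤ) ^ k * ((3 : ℕ) : ℤ))))
    (hunr : (propagatedSelmerStructure W 3 k).IsUnramifiedOutside S)
    (hCR : LocalInvariants.HasCoreRank inv (propagatedSelmerStructureOne W 3) 3 1)
    (hco : inv.IsResiduallyCoisotropic (propagatedSelmerStructureOne W 3) θ S)
    (D : KolyvaginDatum (W.torsionGaloisModule (((3 : ℕ) : ℤ) ^ k * ((3 : ℕ) : ℤ))))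
    (η : (q : HeightOneSpectrum (𝓞 ℚ)) → (ZMod (Ideal.absNorm q.asIdeal))ˣ)
    (hP : D.primes = frobeniusClassPrimes (W.torsionGaloisModule (((3 : ℕ) : ℤ) ^ k * ((3 : ℕ) : ℤ)))
      {v | (Sum.inr v : Place ℚ) ∈ S} τ (3 ^ (k + 1)))
    (hT : D.transverse = cyclotomicTransverse (W.torsionGaloisModule (((3 : ℕ) : ℤ) ^ k * ((3 : ℕ) : ℤ))))
    (hD : D.HasCanonicalComparison (3 ^ (k + 1)) η) :
    KolyvaginSystem.IsFreeRankOneZMod (D.kolyvaginSystems (propagatedSelmerStructure W 3 k))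
      (3 ^ (k + 1)) :=
  (kolyvaginSystems_freeRankOne_propagatedSelmerStructure_deep W hS24d le_rfl h3 τ hτμ hτq hH3 θ hθ
    inv hperf hsum hunro hcompl S hS (fun v hv => (hS' v hv).1) (fun v hv => (hS' v hv).2) hunr hCR hco
    D η hP hT hD).1

end Summit.BirchSwinnertonDyer.Rank1Residual.GaloisImage

end
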